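import Summits.Ventures.CertifiedArithmetic.LowPrec.GemmThetaE4M3Cover
import Summits.Ventures.CertifiedArithmetic.LowPrec.GemmFreeMoves
import Summits.Ventures.CertifiedArithmetic.LowPrec.GemmThetaE4M3Check01
import Summits.Ventures.CertifiedArithmetic.LowPrec.GemmThetaE4M3Check02
import Summits.Ventures.CertifiedArithmetic.LowPrec.GemmThetaE4M3Check03
import Summits.Ventures.CertifiedArithmetic.LowPrec.GemmThetaE4M3Check04
import Summits.Ventures.CertifiedArithmetic.LowPrec.GemmThetaE4M3Check05
import Summits.Ventures.CertifiedArithmetic.LowPrec.GemmThetaE4M3Check06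
import Summits.Ventures.CertifiedArithmetic.LowPrec.GemmThetaE4M3Check07
import Summits.Ventures.CertifiedArithmetic.LowPrec.GemmThetaE4M3Check08
import Summits.Ventures.CertifiedArithmetic.LowPrec.GemmThetaE4M3Check09
import Summits.Ventures.CertifiedArithmetic.LowPrec.GemmThetaE4M3Check10
import Summits.Ventures.CertifiedArithmetic.LowPrec.GemmThetaE4M3Check11
import Summits.Ventures.CertifiedArithmetic.LowPrec.GemmThetaE4M3Check12
import Summits.Ventures.CertifiedArithmetic.LowPrec.GemmThetaE4M3Check13
import Summits.Ventures.CertifiedArithmetic.LowPrec.GemmThetaE4M3Check14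
import Summits.Ventures.CertifiedArithmetic.LowPrec.GemmThetaE4M3Check15
import Summits.Ventures.CertifiedArithmetic.LowPrec.GemmThetaE4M3Check16
import Summits.Ventures.CertifiedArithmetic.LowPrec.GemmThetaE4M3Check17
import Summits.Ventures.CertifiedArithmetic.LowPrec.GemmThetaE4M3Check18
import Summits.Ventures.CertifiedArithmetic.LowPrec.GemmThetaE4M3Check19
import Summits.Ventures.CertifiedArithmetic.LowPrec.GemmThetaE4M3Check20
import Summits.Ventures.CertifiedArithmetic.LowPrec.GemmThetaE4M3Check21
import Summits.Ventures.CertifiedArithmetic.LowPrec.GemmThetaE4M3Check22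
import Summits.Ventures.CertifiedArithmetic.LowPrec.GemmThetaE4M3Check23
import Summits.Ventures.CertifiedArithmetic.LowPrec.GemmThetaE4M3Check24
import Summits.Ventures.CertifiedArithmetic.LowPrec.GemmThetaE4M3Check25
import Summits.Ventures.CertifiedArithmetic.LowPrec.GemmThetaE4M3Check26
import Summits.Ventures.CertifiedArithmetic.LowPrec.GemmThetaE4M3Check27
import Summits.Ventures.CertifiedArithmetic.LowPrec.GemmThetaE4M3Check28
import Summits.Ventures.CertifiedArithmetic.LowPrec.GemmThetaE4M3Check29
import Summits.Ventures.CertifiedArithmetic.LowPrec.GemmThetaE4M3Check30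
import Summits.Ventures.CertifiedArithmetic.LowPrec.GemmThetaE4M3Check31
import Summits.Ventures.CertifiedArithmetic.LowPrec.GemmThetaE4M3Check32
import Summits.Ventures.CertifiedArithmetic.LowPrec.GemmThetaE4M3Check33

/-!
# The θ-certificate of E4M3²→bfloat16, assembled: `thetaCert_E4M3_BFloat16`

HONEST FRAMING (venture CertifiedArithmetic / cell `pub-lowprec`, seat gemm, gen 8): certified error
envelopes and provably optimal rounding/accumulation schemes for low-precision formats under stated
cost models; every table by two implementations; no hardware or vendor claims.

Paper `gemm.tex` §Regimes, Prop. "the terminal constant bounds the defect for every n" (i), instance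
OCP FP8 E4M3·E4M3 products ([MicikeviciusEtAl2022, Table 1]) accumulated sequentially in `bfloat16`
(RNE): the 66 kernel-checked chunk theorems of `GemmThetaE4M3Check01..33.lean` cover all
`2011` letters (`cover_all`), so by the soundness of the compressed format
(`GemmThetaE4M3Cover.lean`) every one of the `2 · 4865 · 2011 = 19 567 030` edges of the reachable
graph satisfies the `Facts`; read through the dictionary `v = V/2^18` (bridge
`GemmGridRoundingWide.lean`) they are the fields of a `ThetaCertificate` (`GemmThetaCertificate.lean`)
with `θ = 34078721/2^24 ≈ 2.0313`, `ρ = 63/2`, `κ = 1/θ` and the free-pair constant `β_pair = 193/2 =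
2 + 3ρ` — the latter DERIVED (`free_pair_bound` + Lemma D `no_consecutive_free_moves` of
`GemmFreeMoves.lean`: the move after a free move is paid), not read off the cell certificate (which
records the sharper `191/2`; the all-`n` constant of `GemmThetaE4M3Bound.lean` uses `193/2`).
-/

namespace Literature.ComputerArithmetic.FloatingPoint

namespace MiniFloat

open Finset ThetaE4M3

namespace ThetaE4M3

/-! ### Every letter is covered -/

/-- Concatenation of covered ranges with the length sum as an explicit equation (keeps numerals
out of unification). [cell] -/
theorem coverRange_append' {a l₁ l₂ l : ℕ} (hl : l₁ + l₂ = l) (h₁ : CoverRange a l₁)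
    (h₂ : CoverRange (a + l₁) l₂) : CoverRange a l :=
  hl ▸ coverRange_append h₁ h₂

/-- ALL `2011` LETTERS ARE COVERED (the 66 chunk theorems, concatenated). [cell certificate,
kernel-checked] -/
theorem cover_all : CoverRange 0 2011 := by
  have h₁ : CoverRange 0 34 := coverRange_of_chunkOK chunk_0
  have h₂ : CoverRange 0 68 := coverRange_append' (by norm_num) h₁ (coverRange_of_chunkOK chunk_34)
  have h₃ : CoverRange 0 100 := coverRange_append' (by norm_num) h₂ (coverRange_of_chunkOK chunk_68)
  have h₄ : CoverRange 0 132 := coverRange_append' (by norm_num) h₃ (coverRange_of_chunkOK chunk_100)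
  have h₅ : CoverRange 0 164 := coverRange_append' (by norm_num) h₄ (coverRange_of_chunkOK chunk_132)
  have h₆ : CoverRange 0 196 := coverRange_append' (by norm_num) h₅ (coverRange_of_chunkOK chunk_164)
  have h₇ : CoverRange 0 228 := coverRange_append' (by norm_num) h₆ (coverRange_of_chunkOK chunk_196)
  have h₈ : CoverRange 0 260 := coverRange_append' (by norm_num) h₇ (coverRange_of_chunkOK chunk_228)
  have h₉ : CoverRange 0 292 := coverRange_append' (by norm_num) h₈ (coverRange_of_chunkOK chunk_260)
  have h₁₀ : CoverRange 0 323 := coverRange_append' (by norm_num) h₉ (coverRange_of_chunkOK chunk_292)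
  have h₁₁ : CoverRange 0 355 := coverRange_append' (by norm_num) h₁₀ (coverRange_of_chunkOK chunk_323)
  have h₁₂ : CoverRange 0 386 := coverRange_append' (by norm_num) h₁₁ (coverRange_of_chunkOK chunk_355)
  have h₁₃ : CoverRange 0 418 := coverRange_append' (by norm_num) h₁₂ (coverRange_of_chunkOK chunk_386)
  have h₁₄ : CoverRange 0 449 := coverRange_append' (by norm_num) h₁₃ (coverRange_of_chunkOK chunk_418)
  have h₁₅ : CoverRange 0 481 := coverRange_append' (by norm_num) h₁₄ (coverRange_of_chunkOK chunk_449)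
  have h₁₆ : CoverRange 0 512 := coverRange_append' (by norm_num) h₁₅ (coverRange_of_chunkOK chunk_481)
  have h₁₇ : CoverRange 0 544 := coverRange_append' (by norm_num) h₁₆ (coverRange_of_chunkOK chunk_512)
  have h₁₈ : CoverRange 0 575 := coverRange_append' (by norm_num) h₁₇ (coverRange_of_chunkOK chunk_544)
  have h₁₉ : CoverRange 0 607 := coverRange_append' (by norm_num) h₁₈ (coverRange_of_chunkOK chunk_575)
  have h₂₀ : CoverRange 0 638 := coverRange_append' (by norm_num) h₁₉ (coverRange_of_chunkOK chunk_607)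
  have h₂₁ : CoverRange 0 670 := coverRange_append' (by norm_num) h₂₀ (coverRange_of_chunkOK chunk_638)
  have h₂₂ : CoverRange 0 702 := coverRange_append' (by norm_num) h₂₁ (coverRange_of_chunkOK chunk_670)
  have h₂₃ : CoverRange 0 734 := coverRange_append' (by norm_num) h₂₂ (coverRange_of_chunkOK chunk_702)
  have h₂₄ : CoverRange 0 765 := coverRange_append' (by norm_num) h₂₃ (coverRange_of_chunkOK chunk_734)
  have h₂₅ : CoverRange 0 797 := coverRange_append' (by norm_num) h₂₄ (coverRange_of_chunkOK chunk_765)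
  have h₂₆ : CoverRange 0 829 := coverRange_append' (by norm_num) h₂₅ (coverRange_of_chunkOK chunk_797)
  have h₂₇ : CoverRange 0 861 := coverRange_append' (by norm_num) h₂₆ (coverRange_of_chunkOK chunk_829)
  have h₂₈ : CoverRange 0 893 := coverRange_append' (by norm_num) h₂₇ (coverRange_of_chunkOK chunk_861)
  have h₂₉ : CoverRange 0 927 := coverRange_append' (by norm_num) h₂₈ (coverRange_of_chunkOK chunk_893)
  have h₃₀ : CoverRange 0 960 := coverRange_append' (by norm_num) h₂₉ (coverRange_of_chunkOK chunk_927)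
  have h₃₁ : CoverRange 0 985 := coverRange_append' (by norm_num) h₃₀ (coverRange_of_chunkOK chunk_960)
  have h₃₂ : CoverRange 0 1009 := coverRange_append' (by norm_num) h₃₁ (coverRange_of_chunkOK chunk_985)
  have h₃₃ : CoverRange 0 1037 := coverRange_append' (by norm_num) h₃₂ (coverRange_of_chunkOK chunk_1009)
  have h₃₄ : CoverRange 0 1064 := coverRange_append' (by norm_num) h₃₃ (coverRange_of_chunkOK chunk_1037)
  have h₃₅ : CoverRange 0 1091 := coverRange_append' (by norm_num) h₃₄ (coverRange_of_chunkOK chunk_1064)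
  have h₃₆ : CoverRange 0 1117 := coverRange_append' (by norm_num) h₃₅ (coverRange_of_chunkOK chunk_1091)
  have h₃₇ : CoverRange 0 1147 := coverRange_append' (by norm_num) h₃₆ (coverRange_of_chunkOK chunk_1117)
  have h₃₈ : CoverRange 0 1176 := coverRange_append' (by norm_num) h₃₇ (coverRange_of_chunkOK chunk_1147)
  have h₃₉ : CoverRange 0 1206 := coverRange_append' (by norm_num) h₃₈ (coverRange_of_chunkOK chunk_1176)
  have h₄₀ : CoverRange 0 1235 := coverRange_append' (by norm_num) h₃₉ (coverRange_of_chunkOK chunk_1206)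
  have h₄₁ : CoverRange 0 1265 := coverRange_append' (by norm_num) h₄₀ (coverRange_of_chunkOK chunk_1235)
  have h₄₂ : CoverRange 0 1295 := coverRange_append' (by norm_num) h₄₁ (coverRange_of_chunkOK chunk_1265)
  have h₄₃ : CoverRange 0 1325 := coverRange_append' (by norm_num) h₄₂ (coverRange_of_chunkOK chunk_1295)
  have h₄₄ : CoverRange 0 1355 := coverRange_append' (by norm_num) h₄₃ (coverRange_of_chunkOK chunk_1325)
  have h₄₅ : CoverRange 0 1386 := coverRange_append' (by norm_num) h₄₄ (coverRange_of_chunkOK chunk_1355)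
  have h₄₆ : CoverRange 0 1417 := coverRange_append' (by norm_num) h₄₅ (coverRange_of_chunkOK chunk_1386)
  have h₄₇ : CoverRange 0 1448 := coverRange_append' (by norm_num) h₄₆ (coverRange_of_chunkOK chunk_1417)
  have h₄₈ : CoverRange 0 1479 := coverRange_append' (by norm_num) h₄₇ (coverRange_of_chunkOK chunk_1448)
  have h₄₉ : CoverRange 0 1510 := coverRange_append' (by norm_num) h₄₈ (coverRange_of_chunkOK chunk_1479)
  have h₅₀ : CoverRange 0 1541 := coverRange_append' (by norm_num) h₄₉ (coverRange_of_chunkOK chunk_1510)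
  have h₅₁ : CoverRange 0 1573 := coverRange_append' (by norm_num) h₅₀ (coverRange_of_chunkOK chunk_1541)
  have h₅₂ : CoverRange 0 1605 := coverRange_append' (by norm_num) h₅₁ (coverRange_of_chunkOK chunk_1573)
  have h₅₃ : CoverRange 0 1635 := coverRange_append' (by norm_num) h₅₂ (coverRange_of_chunkOK chunk_1605)
  have h₅₄ : CoverRange 0 1665 := coverRange_append' (by norm_num) h₅₃ (coverRange_of_chunkOK chunk_1635)
  have h₅₅ : CoverRange 0 1695 := coverRange_append' (by norm_num) h₅₄ (coverRange_of_chunkOK chunk_1665)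
  have h₅₆ : CoverRange 0 1725 := coverRange_append' (by norm_num) h₅₅ (coverRange_of_chunkOK chunk_1695)
  have h₅₇ : CoverRange 0 1755 := coverRange_append' (by norm_num) h₅₆ (coverRange_of_chunkOK chunk_1725)
  have h₅₈ : CoverRange 0 1785 := coverRange_append' (by norm_num) h₅₇ (coverRange_of_chunkOK chunk_1755)
  have h₅₉ : CoverRange 0 1816 := coverRange_append' (by norm_num) h₅₈ (coverRange_of_chunkOK chunk_1785)
  have h₆₀ : CoverRange 0 1847 := coverRange_append' (by norm_num) h₅₉ (coverRange_of_chunkOK chunk_1816)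
  have h₆₁ : CoverRange 0 1878 := coverRange_append' (by norm_num) h₆₀ (coverRange_of_chunkOK chunk_1847)
  have h₆₂ : CoverRange 0 1909 := coverRange_append' (by norm_num) h₆₁ (coverRange_of_chunkOK chunk_1878)
  have h₆₃ : CoverRange 0 1940 := coverRange_append' (by norm_num) h₆₂ (coverRange_of_chunkOK chunk_1909)
  have h₆₄ : CoverRange 0 1971 := coverRange_append' (by norm_num) h₆₃ (coverRange_of_chunkOK chunk_1940)
  have h₆₅ : CoverRange 0 1991 := coverRange_append' (by norm_num) h₆₄ (coverRange_of_chunkOK chunk_1971)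
  have h₆₆ : CoverRange 0 2011 := coverRange_append' (by norm_num) h₆₅ (coverRange_of_chunkOK chunk_1991)
  exact h₆₆

/-- THE FACTS OF EVERY EDGE `(σ, i) → Q` of the reachable graph. [cell certificate, kernel-checked] -/
theorem edge_facts (σ : Bool) {i : ℕ} (hi : i ≤ 4864) {Q : ℤ} (hQ : Q ∈ lamG) : Facts σ i Q :=
  facts_of_cover hQ (coverOK_of_range cover_all hQ) σ hi

/-! ### The dictionary in grid units `2^-18` -/

/-- The bridge applies to every edge: `|V + Q| < 2^64`. [cell] -/
theorem hb64 (σ : Bool) (i : ℕ) {Q : ℤ} (hQ : Q ∈ lamG) : (sval σ i + Q).natAbs < 2 ^ 64 :=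
  natAbs_add_lt64 ((natAbs_sval_le σ i).trans (by norm_num))
    ((natAbs_le_of_mem_lamG hQ).trans (by norm_num))

/-- THE POTENTIAL as a function on `ℚ`: `Φ(v) = psiZ(2^18 v)/2^18`. [cell, gemm.tex §Regimes] -/
def psiG (v : ℚ) : ℚ := (psiZ ⌊v * 2 ^ 18⌋ : ℚ) / 2 ^ 18

/-- `Φ(V/2^18) = psiZ V / 2^18`. [cell] -/
theorem psiG_dyadic (V : ℤ) : psiG ((V : ℚ) / 2 ^ 18) = (psiZ V : ℚ) / 2 ^ 18 := by
  unfold psiG; rw [div_mul_cancel₀ (V : ℚ) (by norm_num : (2 : ℚ) ^ 18 ≠ 0), Int.floor_intCast]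

/-- THE STATE SET: `± valG i / 2^18`, `i ≤ 4864`. [cell, gemm.tex §Regimes] -/
def SG (v : ℚ) : Prop := ∃ σ : Bool, ∃ i : ℕ, i ≤ 4864 ∧ v = (sval σ i : ℚ) / 2 ^ 18

/-- A recognised magnitude is a state. [cell] -/
theorem SG_of_idx {W : ℤ} (h1 : idxG W.natAbs ≤ 4864) (h2 : valG (idxG W.natAbs) = W.natAbs) :
    SG ((W : ℚ) / 2 ^ 18) := by
  refine ⟨decide (W < 0), idxG W.natAbs, h1, ?_⟩
  have : sval (decide (W < 0)) (idxG W.natAbs) = W := by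
    unfold sval; rw [h2]
    by_cases hW : W < 0
    · simp only [hW, decide_true, if_true]; omega
    · simp only [hW, decide_false, Bool.false_eq_true, if_false]; omega
  rw [this]

/-- A state is a `bfloat16` datum. [cell] -/
theorem exists_toRat_eq_sval (σ : Bool) {i : ℕ} (hi : i ≤ 4864) :
    ∃ y : MiniFloat Format.BFloat16, y.toRat = (sval σ i : ℚ) / 2 ^ 18 := by
  have hb : (sval σ i - ((qlo σ i : ℕ) : ℤ)).natAbs < 2 ^ 64 := by
    have := natAbs_sval_le σ i; have := qlo_le σ i; omega
  obtain ⟨y, hy⟩ := exists_toRat_eq_rne8_dyadic g18 _ hb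
  exact ⟨y, by rw [hy, sval_eq_rne8 σ hi]⟩

/-- LEMMA D IN GRID UNITS: the move after a free move is paid (`d' > 0`). [cell, GemmFreeMoves] -/
theorem second_move_paid (σ : Bool) {i : ℕ} (hi : i ≤ 4864) {Q Q' : ℤ} (hQ : Q ∈ lamG)
    (hQ' : Q' ∈ lamG) (hne : WQ σ i Q ≠ sval σ i) (hd0 : defQ σ i Q = 0) {τ : Bool} {j : ℕ}
    (hW : WQ σ i Q = sval τ j) (hne2 : WQ τ j Q' ≠ sval τ j) : 0 < defQ τ j Q' := by
  have h218 : (0 : ℚ) < 2 ^ 18 := by positivity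
  obtain ⟨y, hy⟩ := exists_toRat_eq_sval σ hi
  have hb := hb64 σ i hQ
  have hb' := hb64 τ j hQ'
  unfold WQ at hW hne hne2
  have e1 : (roundNE Format.BFloat16 (y.toRat + (Q : ℚ) / 2 ^ 18)).toRat = (sval τ j : ℚ) / 2 ^ 18 := by
    have := flStep_dyadic64 g18 hb
    unfold flStep at this
    rw [hy, this, hW]
  have e2 : (roundNE Format.BFloat16 ((sval τ j : ℚ) / 2 ^ 18 + (Q' : ℚ) / 2 ^ 18)).toRat
      = (rne8 (sval τ j + Q') : ℚ) / 2 ^ 18 := by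
    have := flStep_dyadic64 g18 hb'
    unfold flStep at this
    exact this
  have hm : 1 ≤ Format.BFloat16.manBits := by rw [BFloat16_manBits]; norm_num
  have hδ : sval τ j - (sval σ i + Q) = (Q.natAbs : ℤ) := by
    unfold defQ gainQ WQ at hd0; rw [hW] at hd0; omega
  have hlt := no_consecutive_free_moves hm y ((Q : ℚ) / 2 ^ 18) ((Q' : ℚ) / 2 ^ 18)
    (by rw [e1, hy]; intro h; exact hne (hW.trans (dyadic_eq_iff.mp h)))
    (by
      rw [e1, hy, abs_div, abs_of_pos h218, ← Int.cast_abs, ← Int.natCast_natAbs, ← add_div,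
        ← sub_div, ← hδ]
      push_cast; ring)
    (by rw [e1, e2]; intro h; exact hne2 (dyadic_eq_iff.mp h))
  rw [e1, e2, abs_div, abs_of_pos h218, ← Int.cast_abs, ← Int.natCast_natAbs, ← add_div, ← sub_div,
    div_lt_div_iff_of_pos_right h218] at hlt
  have h' : rne8 (sval τ j + Q') - (sval τ j + Q') < (Q'.natAbs : ℤ) := by exact_mod_cast hlt
  unfold defQ gainQ WQ
  omega

end ThetaE4M3

/-- THE ALPHABET: the `2011` products `E4M3 · E4M3` as rationals (grid `2^-18`).
[cell, gemm.tex §Regimes; MicikeviciusEtAl2022 Table 1 for the value set] -/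
def piE4M3 : List ℚ := lamG.map fun Q : ℤ => (Q : ℚ) / 2 ^ 18

/-- Every letter of `piE4M3` is `Q/2^18` with `Q ∈ lamG`. [cell] -/
theorem exists_of_mem_piE4M3 {q : ℚ} (hq : q ∈ piE4M3) : ∃ Q ∈ lamG, (Q : ℚ) / 2 ^ 18 = q :=
  List.mem_map.mp hq

/-! ### The certificate -/

/-- THE θ-CERTIFICATE OF E4M3²→bfloat16 (RNE, sequential): letters `piE4M3`, states `SG`, potential
`psiG`, `θ = 34078721/16777216`, `ρ = 63/2`, `β_pair = 193/2`, `κ = 16777216/34078721`.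
[cell certificate, kernel-checked; gemm.tex §Regimes Prop. Θ(i)] -/
theorem thetaCert_E4M3_BFloat16 :
    ThetaCertificate Format.BFloat16 (fun q => q ∈ piE4M3) SG psiG
      (34078721 / 16777216) (63 / 2) (193 / 2) (16777216 / 34078721) where
  θ_pos := by norm_num
  ρ_nonneg := by norm_num
  βp_nonneg := by norm_num
  κ_nonneg := by norm_num
  start := by
    intro q hq
    obtain ⟨Q, hQ, rfl⟩ := exists_of_mem_piE4M3 hq
    have hb : Q.natAbs < 2 ^ 64 := by have := natAbs_le_of_mem_lamG hQ; norm_num; omega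
    have hs := startOK_of_mem hQ
    unfold startOK at hs
    simp only [Bool.and_eq_true, decide_eq_true_eq] at hs
    obtain ⟨⟨⟨⟨h0, h1⟩, h2⟩, h3⟩, -⟩ := hs
    refine ⟨?_, SG_of_idx h1 h2, ?_⟩
    · obtain ⟨y, hy⟩ := exists_toRat_eq_rne8_dyadic g18 Q hb
      exact ⟨y, by rw [hy, h0]⟩
    · rw [psiG_dyadic, abs_div, abs_of_pos (by positivity : (0 : ℚ) < 2 ^ 18), ← Int.cast_abs,
        ← Int.natCast_natAbs]
      have : ((psiZ Q : ℤ) : ℚ) ≤ ((Q.natAbs : ℤ) : ℚ) := by exact_mod_cast h3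
      exact div_le_div_of_nonneg_right (by exact_mod_cast this) (by positivity)
  closed := by
    rintro v q ⟨σ, i, hi, rfl⟩ hq
    obtain ⟨Q, hQ, rfl⟩ := exists_of_mem_piE4M3 hq
    rw [flStep_dyadic64 g18 (hb64 σ i hQ)]
    obtain ⟨τ, j, hj, hW⟩ := isSt_WQ σ i hQ
    unfold WQ at hW
    exact ⟨τ, j, hj, by rw [hW]⟩
  potential := by
    rintro v q ⟨σ, i, hi, rfl⟩ hq hne
    obtain ⟨Q, hQ, rfl⟩ := exists_of_mem_piE4M3 hq
    have hb := hb64 σ i hQ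
    rw [flStep_dyadic64 g18 hb] at hne ⊢
    rw [psiG_dyadic, psiG_dyadic, deficitOf_dyadic64 g18 hb]
    have hne' : WQ σ i Q ≠ sval σ i := fun h => hne (by unfold WQ at h; rw [h])
    obtain ⟨h3, -⟩ := (edge_facts σ hi hQ).2 hne'
    unfold defQ gainQ WQ at h3
    have h3' : ((psiZ (rne8 (sval σ i + Q)) : ℤ) : ℚ)
        ≤ ((psiZ (sval σ i) + ((Q.natAbs : ℤ) - (rne8 (sval σ i + Q) - sval σ i - Q)) : ℤ) : ℚ) := by
      exact_mod_cast h3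
    push_cast at h3' ⊢
    linarith
  capacity := by
    rintro v q ⟨σ, i, hi, rfl⟩ hq habs hneg
    obtain ⟨Q, hQ, rfl⟩ := exists_of_mem_piE4M3 hq
    have hb := hb64 σ i hQ
    rw [flStep_dyadic64 g18 hb, dyadic_eq_iff] at habs
    have hQ0 : Q < 0 := by
      have : (Q : ℚ) < 0 := by
        have h2 : (0 : ℚ) < 2 ^ 18 := by positivity
        by_contra hc; push Not at hc
        exact absurd hneg (not_lt.mpr (div_nonneg hc h2.le))
      exact_mod_cast this
    rw [psiG_dyadic]
    have h := (edge_facts σ hi hQ).1 habs hQ0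
    have h' : ((34078721 * -Q : ℤ) : ℚ) ≤ ((16777216 * psiZ (sval σ i) : ℤ) : ℚ) := by exact_mod_cast h
    push_cast at h'
    rw [show (34078721 : ℚ) / 16777216 * -((Q : ℚ) / 2 ^ 18) = 34078721 * -(Q : ℚ) / 16777216 / 2 ^ 18
      by ring]
    exact div_le_div_of_nonneg_right (by linarith) (by positivity)
  paid := by
    rintro v q ⟨σ, i, hi, rfl⟩ hq hne hpos
    obtain ⟨Q, hQ, rfl⟩ := exists_of_mem_piE4M3 hq
    have hb := hb64 σ i hQ
    have h218 : (0 : ℚ) < 2 ^ 18 := by positivity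
    rw [flStep_dyadic64 g18 hb] at hne
    rw [deficitOf_dyadic64 g18 hb] at hpos ⊢
    rw [gainOf_dyadic64 g18 hb]
    have hne' : WQ σ i Q ≠ sval σ i := fun h => hne (by unfold WQ at h; rw [h])
    have hpos' : 0 < defQ σ i Q := by
      have : (0 : ℚ) < (((Q.natAbs : ℤ) - (rne8 (sval σ i + Q) - sval σ i - Q) : ℤ) : ℚ) := by
        by_contra hc; push Not at hc
        exact absurd hpos (not_lt.mpr (div_nonpos_of_nonpos_of_nonneg hc h218.le))
      unfold defQ gainQ WQ
      exact_mod_cast this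
    obtain ⟨-, hmv⟩ := (edge_facts σ hi hQ).2 hne'
    rcases hmv with ⟨-, h⟩ | ⟨hd, -, -⟩
    · unfold defQ gainQ WQ at h
      have h' : ((2 * (rne8 (sval σ i + Q) - sval σ i - Q) : ℤ) : ℚ)
          ≤ ((63 * ((Q.natAbs : ℤ) - (rne8 (sval σ i + Q) - sval σ i - Q)) : ℤ) : ℚ) := by
        exact_mod_cast h
      push_cast at h' ⊢
      rw [← mul_div_assoc, div_le_div_iff_of_pos_right h218]
      linarith
    · exact absurd hpos' hd
  free := by
    rintro v q ⟨σ, i, hi, rfl⟩ hq hne hd0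
    obtain ⟨Q, hQ, rfl⟩ := exists_of_mem_piE4M3 hq
    have hb := hb64 σ i hQ
    have h218 : (0 : ℚ) < 2 ^ 18 := by positivity
    rw [flStep_dyadic64 g18 hb] at hne ⊢
    rw [deficitOf_dyadic64 g18 hb] at hd0
    rw [gainOf_dyadic64 g18 hb, psiG_dyadic]
    have hne' : WQ σ i Q ≠ sval σ i := fun h => hne (by unfold WQ at h; rw [h])
    have hd0' : defQ σ i Q = 0 := by
      have : ((((Q.natAbs : ℤ) - (rne8 (sval σ i + Q) - sval σ i - Q)) : ℤ) : ℚ) = 0 := by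
        rcases div_eq_zero_iff.mp hd0 with h | h
        · exact h
        · exact absurd h (ne_of_gt h218)
      unfold defQ gainQ WQ
      exact_mod_cast this
    obtain ⟨-, hmv⟩ := (edge_facts σ hi hQ).2 hne'
    rcases hmv with ⟨hd, -⟩ | ⟨-, hκ, haux⟩
    · rw [hd0'] at hd; exact absurd hd (lt_irrefl 0)
    obtain ⟨τ, j, hj, hW, hδ⟩ := freeAux_sound haux
    refine ⟨?_, ?_⟩
    · unfold gainQ WQ at hκ
      have h' : ((34078721 * (rne8 (sval σ i + Q) - sval σ i - Q) : ℤ) : ℚ)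
          ≤ ((16777216 * psiZ (sval σ i) : ℤ) : ℚ) := by exact_mod_cast hκ
      push_cast at h' ⊢
      rw [← mul_div_assoc, div_le_div_iff_of_pos_right h218]
      linarith
    · intro q' hq' hne2
      obtain ⟨Q', hQ', rfl⟩ := exists_of_mem_piE4M3 hq'
      have hWZ : rne8 (sval σ i + Q) = sval τ j := hW
      rw [hWZ] at hne2 ⊢
      have hb' := hb64 τ j hQ'
      rw [flStep_dyadic64 g18 hb'] at hne2
      rw [gainOf_dyadic64 g18 hb', deficitOf_dyadic64 g18 hb']
      have hne2' : WQ τ j Q' ≠ sval τ j := fun h => hne2 (by unfold WQ at h; rw [h])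
      have hd' := second_move_paid σ hi hQ hQ' hne' hd0' hW hne2'
      obtain ⟨-, hmv'⟩ := (edge_facts τ hj hQ').2 hne2'
      rcases hmv' with ⟨-, hpaid'⟩ | ⟨hnd, -, -⟩
      · have key := free_pair_bound hj hδ hne2' hpaid'
        unfold defQ gainQ WQ at key
        rw [hWZ] at key
        have h' : ((2 * ((sval τ j - sval σ i - Q) + (rne8 (sval τ j + Q') - sval τ j - Q')) : ℤ) : ℚ)
            ≤ ((193 * ((Q'.natAbs : ℤ) - (rne8 (sval τ j + Q') - sval τ j - Q')) - 2 : ℤ) : ℚ) := by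
          exact_mod_cast key
        push_cast at h' ⊢
        rw [← add_div, ← mul_div_assoc, div_le_div_iff_of_pos_right h218]
        linarith
      · exact absurd hd' hnd

end MiniFloat

end Literature.ComputerArithmetic.FloatingPoint
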